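import Summits.QuantumFields.YangMills.Theorems.FemtoTransferGapLevels
import Summits.QuantumFields.YangMills.Theorems.FemtoTransferGapRungW1upAlgebra
import HarnessLib

/-!
# Crux RED `RunningReduction`, line «KTR» rev 6, PART 5 «TT» §1: the zero-flux trace objects re-homed on the Theorems side
# (`centreElem`, `twist3`, `gaugeMeasure`, `physAvg`, `physTraceSucc`, `physTrace`) + the physically averaged bond kernel `physKernel`

Support module (fleet service by seat ym-infvol-p1 g3; route owner ym-beyond-p1 g18 PROGRESS 3, ym-beyond bus 2026-08-27T06:21:40Z,
ask (δ) «an idle M-seat on the TT door takes `stub_traceFormula`») for crux `RunningReduction` (route `LuscherReduction`, item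
stmt-QuantumFields-19978).  DEFINITIONS ONLY, VERBATIM from the registered skeleton `Cruxes/RunningReduction/Lines/ktr.lean` rev 6
(sha16 002f86ce3585fcf4) PART 5 §1 — `centreElem`, `twist3`, `gaugeMeasure`, `physAvg`, `physTraceSucc`, `physTrace` — over tree
constants (the skeleton's local `negOne` is the tree's `FemtoTransferGap.negOne`, `Theorems/FemtoTransferGapRungW1upAlgebra.lean`, same
term), so that the owner can re-point `TT.TraceFormula` ∕ `Stmt.stub_traceFormula` at these objects exactly as was done for
`ExplicitNoIntruder` (p500991).  One addition of this seat: `physKernel β U V := physAvg (K_β U ·) V` — the PHYSICALLY AVERAGED BOND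
KERNEL `K_β^P(U,V) = (1/8) Σ_z ∫ K_β(U, g·tw_z V) dg`, the kernel of `K_β P = P K_β` (`P` = the orthogonal projection onto the physical closed
subspace `physL2 L`): the closing bond of `physTraceSucc`.  The statement `TT.TraceFormula` itself is NOT re-declared here (a parameter-free `def : Prop` would read as a vendored fact): the companion
module `Theorems/LuscherReductionRunningReductionTraceFormula.lean` proves its BODY verbatim over these objects,
`∀ L β T, 1 ≤ β → 2 ≤ T → HasSum (fun k => levelValue su2Rep L β k ^ T) (physTrace L β T)`.

HONEST FRAMING: fixed-lattice bookkeeping for the femto rung R2b1; no renormalisation-group content; nothing here bears on infinite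
volume, the continuum limit or the Clay gap.
References: [cite: Luscher1983, §2]; [cite: MontvayMunster1994, (3.145)]; [cite: ReedSimonIV1978, Thm. XIII.1].
-/

set_option autoImplicit false

noncomputable section

open MeasureTheory Filter Topology Real
open Literature.MathematicalPhysics.QuantumFieldTheory
open Literature.MathematicalPhysics.QuantumLattice
open Literature.Analysis.OperatorTheory.YMMatrixModel
open scoped BigOperators

namespace Summit.QuantumFields.YangMills.Theorems.FemtoTransferGap.TT

open Summit.QuantumFields.YangMills.Theorems.FemtoTransferGap

/-- Centre element of `SU(2)` labelled by a bit (`ℤ/2 ≅ Z(SU(2))`: `true ↦ −𝟙`, `false ↦ 𝟙`). [cite: Luscher1983, §2] -/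
def centreElem (b : Bool) : SU2 := if b then negOne else 1

/-- The composite centre twist `z ∈ (ℤ/2)³` through the three planes `x_k = 0` (tree `twist`, one bit per direction).
[cite: tHooft1979] [cite: Luscher1983, §2] -/
def twist3 {L : ℕ} (z : Fin 3 → Bool) (U : GaugeConfig 3 L SU2) : GaugeConfig 3 L SU2 :=
  twist 0 (centreElem (z 0)) (twist 1 (centreElem (z 1)) (twist 2 (centreElem (z 2)) U))

/-- Haar probability on the gauge group `SU(2)^{sites}` of the spatial torus `(ℤ/L)³`. [cite: Luscher1983, §2] -/
def gaugeMeasure (L : ℕ) [NeZero L] : Measure (Site 3 L → SU2) :=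
  Measure.pi fun _ : Site 3 L => haarProbability SU2

/-- **Physical average** `(P f)(U) = (1/8) Σ_{z ∈ (ℤ/2)³} ∫ f(g · tw_z U) dg`: the orthogonal projection of `L²(configMeasure)` onto the
physical zero-flux functions (Gauss law × electric flux `e = 0`), written on a kernel slot. [cite: Luscher1983, §2] -/
def physAvg {L : ℕ} [NeZero L] (f : GaugeConfig 3 L SU2 → ℝ) (U : GaugeConfig 3 L SU2) : ℝ :=
  (1 / 8 : ℝ) * ∑ z : Fin 3 → Bool, ∫ g, f (gaugeTransform g (twist3 z U)) ∂(gaugeMeasure L)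

/-- **Zero-flux trace of `n+1` transfer steps** `Z_phys(L, β, n+1) = Tr (P K_β)^{n+1}`: a CLOSED CHAIN of `n+1` kernels on `n+1` time
slices, the seam `U_n → U_0` carrying the physical average — Wilson's theory on the asymmetric torus `(ℤ/L)³ × (ℤ/(n+1))` in axial gauge
with temporal boundary conditions periodic up to a gauge transformation and a temporal 't Hooft twist, averaged over the `8` twists.
[cite: MontvayMunster1994, (3.145)] -/
def physTraceSucc (L : ℕ) [NeZero L] (β : ℝ) (n : ℕ) : ℝ :=
  ∫ Us : Fin (n + 1) → GaugeConfig 3 L SU2,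
    (∏ i : Fin n, transferKernel su2Rep β (Us i.castSucc) (Us i.succ)) *
      physAvg (transferKernel su2Rep β (Us (Fin.last n))) (Us 0)
    ∂(Measure.pi fun _ : Fin (n + 1) => configMeasure SU2 L)

/-- `Z_phys(L, β, T)` for `T ≥ 1` time steps (`T = 0` ↦ the one-step value, a junk convention never used). [cite: MontvayMunster1994, (3.145)] -/
def physTrace (L : ℕ) [NeZero L] (β : ℝ) (T : ℕ) : ℝ := physTraceSucc L β (T - 1)

/-- **The physically averaged bond kernel** `K_β^P(U, V) = (P K_β(U, ·))(V) = (1/8) Σ_z ∫ K_β(U, g · tw_z V) dg` — the closing bond of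
`physTraceSucc`; it is the (bounded, symmetric) kernel of `K_β P = P K_β`, `P` the projection onto the physical closed subspace.
[cite: Luscher1983, §2] -/
def physKernel {L : ℕ} [NeZero L] (β : ℝ) (U V : GaugeConfig 3 L SU2) : ℝ :=
  physAvg (transferKernel su2Rep β U) V

end Summit.QuantumFields.YangMills.Theorems.FemtoTransferGap.TT

end
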